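import Summits.CriticalPhenomena.CardyFormulaZ2.Theorems.CardyFlipRussoVoronoiHubFromSmirnovDelaunayImageClearance
import Summits.CriticalPhenomena.CardyFormulaZ2.Theorems.CardyFlipRussoVoronoiHubFromSmirnovVoronoiCellSides
import Summits.CriticalPhenomena.CardyFormulaZ2.Theorems.CardyFlipRussoVoronoiHubFromSmirnovDelaunayPivot
import Summits.CriticalPhenomena.CardyFormulaZ2.Theorems.CardyFlipRussoVoronoiHubFromSmirnovPencilTie
import Summits.CriticalPhenomena.CardyFormulaZ2.Theorems.CardyFlipRussoVoronoiHubFromSmirnovPencilFermat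

/-!
# Stub `defect_implies_potentialDefect` of line `moebius-exact-delaunay-dilation-ward`
# (crux `VoronoiHubFromSmirnov`, stmt-CriticalPhenomena-6433)

DEFECTS ONLY OCCUR AT POTENTIAL DEFECTS (I. Benjamini, O. Schramm, *Conformal invariance of
Voronoi percolation*, Comm. Math. Phys. 197 (1998) 75–107, Lemma 4.2, planar case, assembled from
the landed bricks of the line).  Let `h` be `C^{1,1}`-conformal on a convex set `B`
(`m ≤ ‖h'‖ ≤ Λ`, `‖h''‖ ≤ L`, `h''` `L`-Lipschitz, injectivity modulus `dist z w ≥ R₁ ⇒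
dist (h z) (h w) ≥ η`).  Then there are constants `W`, `ℓ₀ > 0` such that for every locally
finite `ω ⊆ B`, every Delaunay pair `p ≠ q` of `ω` whose Voronoi cell `V(p)` is small
(`V(p) ⊆ closedBall p ℓ`, `ℓ ≤ ℓ₀`, `closedBall p (4ℓ) ⊆ B`) but whose image `h p, h q` is NOT a
Delaunay pair of `h '' ω` (a *defect*), one of the two *potential defect* configurations occurs:
* a NAVEL: a centre `x` equidistant from `p`, `q` (`dist p x = dist q x ≤ ℓ`) carrying an empty
  disc through `p`, `q`, and two further distinct sites `a, b` tied at a common distance from `x`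
  which is `< dist p x + W ℓ³`; or
* a CLOSE PAIR: a third site `a` within `W ℓ³` of `p` or of `q`.

Proof (pure assembly).
1. `isDelaunayPair_image_of_clearance` gives `W, r₀`: an empty disc through `p, q` of radius
   `r ≤ r₀` with clearance `W r³` to all other sites forces the image pair to be Delaunay.  We
   output `|W| + 1` and `ℓ₀ = r₀`; put `τ = (|W| + 1) ℓ³`.
2. `exists_site_left_of_voronoiCell_bounded` (applied to `(p, q)` and to `(p, 2p − q)`) gives
   sites strictly on both sides of the line `p q`; `delaunay_pivot_exists_third` (applied to
   `(p, q)` and to `(q, p)`) gives two empty discs through `p, q` touching third sites `z₋`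
   (strictly left) and `z₊` (strictly right); their centres are `c t_a`, `c t_b` on the pencil
   `c t = p + (1/2 + t i)(q − p)` (`dp_center_param`, `pt_center_eq`).
3. By the pencil identity (`pt_key`) the power `dist(d, c t)² − dist(p, c t)²` is affine in
   `t`, so every disc of the pencil with parameter between `t_a` and `t_b` is empty
   (`dpd_affine_nonneg`); its centre lies in `V(p) ⊆ closedBall p ℓ`, so its radius is `≤ ℓ`
   and `closedBall (c t) (2 · radius) ⊆ closedBall p (4ℓ) ⊆ B`.
4. Since the image pair is not Delaunay, step 1 (contrapositive) produces at every such
   parameter a competitor `d ∉ {p, q}` with `dist(d, c t) < radius + τ`; all these competitors,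
   and `z₋, z₊`, lie in the finite set `F = ω ∩ closedBall p (2ℓ + τ) ∖ {p, q}`.
5. The tie-or-Fermat dichotomy `pt_geom` (core of `pencil_tie_or_localMax`) on `F` gives either
   a tie of two distinct sites at the minimal distance (the NAVEL), or an interior local maximum
   of a single clearance, which by `pf_core` (core of `pencil_localMax_dist_eq`) means
   `dist d p < τ` or `dist d q < τ` (the CLOSE PAIR).

No new definitions.
-/

noncomputable section

namespace Summit.CriticalPhenomena.CardyFormulaZ2.Cruxes.VoronoiHubFromSmirnov.MoebiusExactDelaunayDilationWard

open Set Metric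

/-- An affine function of `t` (here `A − 2 t σ`) that is nonnegative at `t₁` and at `t₂` is
nonnegative on `[t₁, t₂]`. [folklore] -/
theorem dpd_affine_nonneg {A σ t₁ t₂ t : ℝ} (h₁ : 0 ≤ A - 2 * t₁ * σ) (h₂ : 0 ≤ A - 2 * t₂ * σ)
    (ht₁ : t₁ ≤ t) (ht₂ : t ≤ t₂) : 0 ≤ A - 2 * t * σ := by
  rcases le_or_gt 0 σ with hσ | hσ
  · nlinarith [mul_le_mul_of_nonneg_right ht₂ hσ]
  · nlinarith [mul_le_mul_of_nonneg_right ht₁ (neg_nonneg.2 hσ.le)]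

/-- Side of the reflected point: a site strictly to the left of the directed line from `p` to
`p − (q − p) = 2p − q` is strictly to the left of the directed line from `q` to `p`. [folklore] -/
theorem dpd_im_aux1 (p q d : ℂ) :
    (starRingEnd ℂ (p - (q - p) - p) * (d - p)).im = (starRingEnd ℂ (p - q) * (d - q)).im := by
  simp only [Complex.mul_im, Complex.conj_re, Complex.conj_im, Complex.sub_re, Complex.sub_im]
  ring

/-- Strictly left of `q → p` is strictly right of `p → q`:
`Im (conj (p − q)(d − q)) = − Im (conj (q − p)(d − p))`. [folklore] -/
theorem dpd_im_aux2 (p q d : ℂ) :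
    (starRingEnd ℂ (p - q) * (d - q)).im = -(starRingEnd ℂ (q - p) * (d - p)).im := by
  simp only [Complex.mul_im, Complex.conj_re, Complex.conj_im, Complex.sub_re, Complex.sub_im]
  ring

/-- A point strictly off the line `p q` (`Im (conj (q − p)(z − p)) ≠ 0`) differs from `p` and
from `q`. [folklore] -/
theorem dpd_ne_of_im_ne {p q z : ℂ} (h : (starRingEnd ℂ (q - p) * (z - p)).im ≠ 0) :
    z ≠ p ∧ z ≠ q := by
  constructor
  · rintro rfl
    apply h
    simp only [Complex.mul_im, Complex.conj_re, Complex.conj_im, Complex.sub_re, Complex.sub_im]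
    ring
  · rintro rfl
    apply h
    simp only [Complex.mul_im, Complex.conj_re, Complex.conj_im, Complex.sub_re, Complex.sub_im]
    ring

/-- **Steps 3–5 of the assembly (abstract pencil of centres).**  Along the pencil
`c t = p + (1/2 + t i)(q − p)`: if the discs at parameters `t₁ ≤ t₂` are empty (for all of `ω`)
and touched by distinct sites `z₁, z₂ ∈ ω ∖ {p, q}`, the Voronoi cell of `p` lies in
`closedBall p ℓ`, and every empty disc of the pencil of radius `≤ ℓ` has a competitor
`d ∉ {p, q}` at distance `< radius + τ` from its centre, then a navel with tie value
`< radius + τ` or a close pair at distance `< τ` occurs. [folklore] -/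
theorem dpd_finish {ω : Set ℂ} {p q z₁ z₂ : ℂ} {ℓ τ t₁ t₂ : ℝ} (c : ℝ → ℂ)
    (hc : ∀ t, c t = p + ((1/2 : ℂ) + (t : ℂ) * Complex.I) * (q - p))
    (hfin : ∀ K : Set ℂ, IsCompact K → (ω ∩ K).Finite) (hpq : p ≠ q) (hτ : 0 < τ)
    (hcell : Literature.Probability.LatticeModels.voronoiCell ω p ⊆ Metric.closedBall p ℓ)
    (hfail : ∀ x : ℂ, 0 < dist p x → dist p x ≤ ℓ → dist q x = dist p x →
      ∃ d ∈ ω, d ≠ p ∧ d ≠ q ∧ dist d x < dist p x + τ)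
    (ht : t₁ ≤ t₂) (hz₁ : z₁ ∈ ω) (hz₂ : z₂ ∈ ω) (hz : z₁ ≠ z₂)
    (hz₁p : z₁ ≠ p) (hz₁q : z₁ ≠ q) (hz₂p : z₂ ≠ p) (hz₂q : z₂ ≠ q)
    (hz₁eq : dist z₁ (c t₁) = dist p (c t₁)) (hz₂eq : dist z₂ (c t₂) = dist p (c t₂))
    (he₁ : ∀ d ∈ ω, dist p (c t₁) ≤ dist d (c t₁))
    (he₂ : ∀ d ∈ ω, dist p (c t₂) ≤ dist d (c t₂)) :
    (∃ (x a b : ℂ), a ∈ ω ∧ b ∈ ω ∧ a ≠ b ∧ a ≠ p ∧ a ≠ q ∧ b ≠ p ∧ b ≠ q ∧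
        dist p x = dist q x ∧ dist p x ≤ ℓ ∧ (∀ d ∈ ω, dist p x ≤ dist d x) ∧
        dist a x = dist b x ∧ dist a x < dist p x + τ) ∨
      (∃ a ∈ ω, a ≠ p ∧ a ≠ q ∧ (dist a p < τ ∨ dist a q < τ)) := by
  classical
  -- pencil facts
  have hkey : ∀ (d : ℂ) (t : ℝ), dist d (c t) ^ 2 - dist p (c t) ^ 2 =
      Complex.normSq (d - p) - (starRingEnd ℂ (q - p) * (d - p)).re
        - 2 * t * (starRingEnd ℂ (q - p) * (d - p)).im := fun d t => by
    rw [hc]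
    exact pt_key p q d t
  have hcq : ∀ t, dist q (c t) = dist p (c t) := fun t => by
    rw [hc]
    exact pf_dist_q p q t
  have hv : 0 < ‖q - p‖ := norm_pos_iff.mpr (sub_ne_zero.mpr hpq.symm)
  have hR0 : ∀ t, 0 < dist p (c t) := fun t => by
    have h2 : 0 < dist p (c t) ^ 2 := by
      rw [hc, pf_dist_p_sq]
      exact mul_pos (pow_pos hv 2) (by positivity)
    exact lt_of_le_of_ne dist_nonneg fun h0 => by
      rw [← h0] at h2
      norm_num at h2
  have hcont : Continuous c :=
    (by fun_prop : Continuous fun t : ℝ => p + ((1/2 : ℂ) + (t : ℂ) * Complex.I) * (q - p)).congr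
      fun t => (hc t).symm
  -- Step 3: every intermediate disc of the pencil is empty, of radius `≤ ℓ`
  have hemp : ∀ t ∈ Set.Icc t₁ t₂, ∀ d ∈ ω, dist p (c t) ≤ dist d (c t) := fun t ht d hd => by
    have h1 := (sq_le_sq₀ dist_nonneg dist_nonneg).2 (he₁ d hd)
    have h2 := (sq_le_sq₀ dist_nonneg dist_nonneg).2 (he₂ d hd)
    rw [← sq_le_sq₀ dist_nonneg dist_nonneg, ← sub_nonneg, hkey]
    exact dpd_affine_nonneg (by linarith [hkey d t₁]) (by linarith [hkey d t₂]) ht.1 ht.2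
  have hcen : ∀ t ∈ Set.Icc t₁ t₂, dist p (c t) ≤ ℓ := fun t ht => by
    have hmem : c t ∈ Metric.closedBall p ℓ := hcell (by
      intro d hd
      rw [dist_comm (c t) p, dist_comm (c t) d]
      exact hemp t ht d hd)
    rw [dist_comm]
    exact Metric.mem_closedBall.1 hmem
  -- Step 4: clearance fails at every intermediate parameter; the finite competitor set
  have hclr : ∀ t ∈ Set.Icc t₁ t₂, ∃ d ∈ ω, d ≠ p ∧ d ≠ q ∧ dist d (c t) < dist p (c t) + τ :=
    fun t ht => hfail (c t) (hR0 t) (hcen t ht) (hcq t)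
  obtain ⟨F, hF⟩ : ∃ F : Finset ℂ, ∀ d, d ∈ F ↔ d ≠ q ∧ d ≠ p ∧ d ∈ ω ∧ dist d p ≤ 2 * ℓ + τ := by
    refine ⟨((hfin _ (isCompact_closedBall p (2 * ℓ + τ))).toFinset.erase p).erase q, fun d => ?_⟩
    rw [Finset.mem_erase, Finset.mem_erase, Set.Finite.mem_toFinset, Set.mem_inter_iff,
      Metric.mem_closedBall]
  have hpF : p ∉ F := fun h => ((hF p).1 h).2.1 rfl
  have hqF : q ∉ F := fun h => ((hF q).1 h).1 rfl
  have hFω : ∀ d ∈ F, d ∈ ω := fun d hd => ((hF d).1 hd).2.2.1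
  have hmemF : ∀ d ∈ ω, d ≠ p → d ≠ q → ∀ t ∈ Set.Icc t₁ t₂,
      dist d (c t) < dist p (c t) + τ → d ∈ F :=
    fun d hd hdp hdq t ht hlt => (hF d).2 ⟨hdq, hdp, hd, by
      linarith [dist_triangle d (c t) p, hcen t ht, dist_comm p (c t)]⟩
  have hz₁F : z₁ ∈ F :=
    hmemF z₁ hz₁ hz₁p hz₁q t₁ (Set.left_mem_Icc.2 ht) (by rw [hz₁eq]; linarith)
  have hz₂F : z₂ ∈ F :=
    hmemF z₂ hz₂ hz₂p hz₂q t₂ (Set.right_mem_Icc.2 ht) (by rw [hz₂eq]; linarith)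
  -- Step 5: the tie-or-Fermat dichotomy along the pencil
  have hgeom := pt_geom (F := F) (τ := τ) (c := c)
    (σ := fun d => (starRingEnd ℂ (q - p) * (d - p)).im)
    (A := fun d => Complex.normSq (d - p) - (starRingEnd ℂ (q - p) * (d - p)).re)
    hcont (fun d t => hkey d t) (fun d hA hσ => pt_deg hpq hA hσ) ht hτ hpF hqF hz₁F hz₂F hz
    hz₁eq hz₂eq (fun d hd t ht => hemp t ht d (hFω d hd))
    (fun t ht => by
      obtain ⟨d, hd, hdp, hdq, hlt⟩ := hclr t ht
      exact ⟨d, hmemF d hd hdp hdq t ht hlt, hlt⟩)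
  rcases hgeom with ⟨t, htI, a, ha, b, hb, hab, hdab, haτ, -⟩ | ⟨t, htI, d, hd, hloc, hdτ⟩
  · -- a tie at the minimal distance: the navel
    obtain ⟨haq, hap, haω, -⟩ := (hF a).1 ha
    obtain ⟨hbq, hbp, hbω, -⟩ := (hF b).1 hb
    exact Or.inl ⟨c t, a, b, haω, hbω, hab, hap, haq, hbp, hbq, (hcq t).symm, hcen t htI,
      hemp t htI, hdab, haτ⟩
  · -- an interior local maximum of a single clearance: a close pair (Fermat case)
    have hI : t ∈ Set.Icc t₁ t₂ := Set.Ioo_subset_Icc_self htI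
    obtain ⟨hdq, hdp, hdω, -⟩ := (hF d).1 hd
    refine Or.inr ⟨d, hdω, hdp, hdq, ?_⟩
    rcases pf_core c hc hpq (hemp t hI d hdω) hloc with h | h
    · exact Or.inl (by linarith)
    · exact Or.inr (by linarith)

/-- **Steps 2–5 of the assembly.**  For a locally finite `ω`, a Delaunay pair `p ≠ q` of `ω` with
`V(p) ⊆ closedBall p ℓ`, and the pencil `c t = p + (1/2 + t i)(q − p)`: if every empty disc of
the pencil of radius `≤ ℓ` has a competitor `d ∉ {p, q}` at distance `< radius + τ` from its
centre, then a navel (tie value `< radius + τ`) or a close pair (distance `< τ`) occurs.  Pivoting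
on both sides of the line `p q` (`exists_site_left_of_voronoiCell_bounded`,
`delaunay_pivot_exists_third`) supplies the interval of empty discs for `dpd_finish`.
[folklore] -/
theorem dpd_core {ω : Set ℂ} {p q : ℂ} {ℓ τ : ℝ} (c : ℝ → ℂ)
    (hc : ∀ t, c t = p + ((1/2 : ℂ) + (t : ℂ) * Complex.I) * (q - p))
    (hfin : ∀ K : Set ℂ, IsCompact K → (ω ∩ K).Finite) (hp : p ∈ ω) (hq : q ∈ ω) (hpq : p ≠ q)
    (hτ : 0 < τ)
    (hcell : Literature.Probability.LatticeModels.voronoiCell ω p ⊆ Metric.closedBall p ℓ)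
    (hDel : Literature.Probability.LatticeModels.IsDelaunayPair ω p q)
    (hfail : ∀ x : ℂ, 0 < dist p x → dist p x ≤ ℓ → dist q x = dist p x →
      ∃ d ∈ ω, d ≠ p ∧ d ≠ q ∧ dist d x < dist p x + τ) :
    (∃ (x a b : ℂ), a ∈ ω ∧ b ∈ ω ∧ a ≠ b ∧ a ≠ p ∧ a ≠ q ∧ b ≠ p ∧ b ≠ q ∧
        dist p x = dist q x ∧ dist p x ≤ ℓ ∧ (∀ d ∈ ω, dist p x ≤ dist d x) ∧
        dist a x = dist b x ∧ dist a x < dist p x + τ) ∨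
      (∃ a ∈ ω, a ≠ p ∧ a ≠ q ∧ (dist a p < τ ∨ dist a q < τ)) := by
  -- Step 2a: sites strictly on both sides of the line `p q`
  obtain ⟨dL, hdL, hσL⟩ := exists_site_left_of_voronoiCell_bounded ω p q ℓ hpq hcell
  have hpq' : p ≠ p - (q - p) := fun h => hpq (by linear_combination -h)
  obtain ⟨dR, hdR, hσR⟩ :=
    exists_site_left_of_voronoiCell_bounded ω p (p - (q - p)) ℓ hpq' hcell
  rw [dpd_im_aux1] at hσR
  -- Step 2b: pivot on both sides
  obtain ⟨zm, hzm, hσm, cm, rm, hpcm, hqcm, hzcm, hem⟩ :=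
    delaunay_pivot_exists_third ω p q hp hq hpq hfin hDel ⟨dL, hdL, hσL⟩
  obtain ⟨zp, hzp, hσp, cp, rp, hqcp, hpcp, hzcp, hep⟩ :=
    delaunay_pivot_exists_third ω q p hq hp hpq.symm hfin hDel.symm ⟨dR, hdR, hσR⟩
  rw [dpd_im_aux2] at hσp
  -- Step 2c: parametrise the two centres along the pencil
  obtain ⟨ta, hta⟩ := dp_center_param hpq (hpcm.trans hqcm.symm)
  obtain ⟨tb, htb⟩ := dp_center_param hpq (hpcp.trans hqcp.symm)
  have hca : cm = c ta := by
    rw [hc, pt_center_eq]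
    exact hta
  have hcb : cp = c tb := by
    rw [hc, pt_center_eq]
    exact htb
  subst hca hcb
  subst hpcm hpcp
  -- the two touching sites are distinct and off the line
  have hne : zm ≠ zp := fun h => by
    rw [h] at hσm
    linarith
  obtain ⟨hzmp, hzmq⟩ := dpd_ne_of_im_ne hσm.ne'
  obtain ⟨hzpp, hzpq⟩ := dpd_ne_of_im_ne (neg_pos.1 hσp).ne
  rcases le_total ta tb with hab | hba
  · exact dpd_finish c hc hfin hpq hτ hcell hfail hab hzm hzp hne hzmp hzmq hzpp hzpq hzcm hzcp
      hem hep
  · exact dpd_finish c hc hfin hpq hτ hcell hfail hba hzp hzm hne.symm hzpp hzpq hzmp hzmq hzcp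
      hzcm hep hem

/-- **BS98 Lemma 4.2 (planar): defects of the conformal transport of a Voronoi tessellation only
occur at potential defects** (stub `defect_implies_potentialDefect` of the line
`moebius-exact-delaunay-dilation-ward`).  Under the `C^{1,1}`-conformality hypotheses on the
convex set `B` and the injectivity modulus, there are `W` and `ℓ₀ > 0` such that for a locally
finite `ω ⊆ B`, a Delaunay pair `p ≠ q` of `ω` with `V(p) ⊆ closedBall p ℓ`, `0 < ℓ ≤ ℓ₀`,
`closedBall p (4ℓ) ⊆ B`, whose image is not a Delaunay pair of `h '' ω`, either a navel (empty
disc through `p, q` of radius `≤ ℓ` centred at `x`, two further distinct sites tied at distance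
`< dist p x + W ℓ³` from `x`) or a close pair (a third site within `W ℓ³` of `p` or `q`) occurs.
Context: I. Benjamini, O. Schramm, Comm. Math. Phys. 197 (1998), Lemma 4.2. [folklore] -/
theorem defect_implies_potentialDefect : ∀ (h h₁ h₂ : ℂ → ℂ) (B : Set ℂ) (L m Λ η R₁ : ℝ), Convex ℝ B → 0 < m → 0 < η → 0 < R₁ → R₁ ≤ m / (4 * (L + 1)) → (∀ z ∈ B, HasDerivAt h (h₁ z) z) → (∀ z ∈ B, HasDerivAt h₁ (h₂ z) z) → (∀ z ∈ B, m ≤ ‖h₁ z‖) → (∀ z ∈ B, ‖h₁ z‖ ≤ Λ) → (∀ z ∈ B, ‖h₂ z‖ ≤ L) → (∀ z ∈ B, ∀ w ∈ B, ‖h₂ z - h₂ w‖ ≤ L * ‖z - w‖) → (∀ z ∈ B, ∀ w ∈ B, R₁ ≤ dist z w → η ≤ dist (h z) (h w)) → ∃ W ℓ₀ : ℝ, 0 < ℓ₀ ∧ ∀ (ω : Set ℂ) (p q : ℂ) (ℓ : ℝ), ω ⊆ B → (∀ K : Set ℂ, IsCompact K → (ω ∩ K).Finite) → p ∈ ω →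 q ∈ ω → p ≠ q → 0 < ℓ → ℓ ≤ ℓ₀ → Metric.closedBall p (4 * ℓ) ⊆ B → Literature.Probability.LatticeModels.voronoiCell ω p ⊆ Metric.closedBall p ℓ → Literature.Probability.LatticeModels.IsDelaunayPair ω p q → ¬ Literature.Probability.LatticeModels.IsDelaunayPair (h '' ω) (h p) (h q) → (∃ (x a b : ℂ), a ∈ ω ∧ b ∈ ω ∧ a ≠ b ∧ a ≠ p ∧ a ≠ q ∧ b ≠ p ∧ b ≠ q ∧ dist p x = dist q x ∧ dist p x ≤ ℓ ∧ (∀ d ∈ ω, dist p x ≤ dist d x) ∧ dist a x = dist b x ∧ dist a x < dist p x + W * ℓ ^ 3) ∨ (∃ a ∈ ω, a ≠ p ∧ a ≠ q ∧ (dist a p < W * ℓ ^ 3 ∨ dist a q < W * ℓ ^ 3)) := by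
  intro h h₁ h₂ B L m Λ η R₁ hB hm hη hR₁ hR₁m hd1 hd2 hm1 hΛ1 hL2 hLip hinj
  obtain ⟨W, r₀, hr₀, hG⟩ := isDelaunayPair_image_of_clearance h h₁ h₂ B L m Λ η R₁ hB hm hη hR₁
    hR₁m hd1 hd2 hm1 hΛ1 hL2 hLip hinj
  refine ⟨|W| + 1, r₀, hr₀, ?_⟩
  intro ω p q ℓ hωB hfin hp hq hpq hℓ hℓ₀ hB4 hcell hDel hdef
  have hτ : 0 < (|W| + 1) * ℓ ^ 3 := by positivity
  refine dpd_core (fun t : ℝ => p + ((1/2 : ℂ) + (t : ℂ) * Complex.I) * (q - p)) (fun _ => rfl)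
    hfin hp hq hpq hτ hcell hDel fun x hr hrℓ hqx => ?_
  -- Step 1 (contrapositive): clearance `W r³` at `x` would make the image pair Delaunay
  by_contra hcon
  push Not at hcon
  refine hdef (hG ω x p q (dist p x) hωB hr (hrℓ.trans hℓ₀) (fun y hy => hB4 ?_) hp hq rfl hqx
    fun d hd hdp hdq => ?_)
  · rw [Metric.mem_closedBall] at hy ⊢
    linarith [dist_triangle y x p, dist_comm p x]
  · have h1 : W * dist p x ^ 3 ≤ |W| * dist p x ^ 3 :=
      mul_le_mul_of_nonneg_right (le_abs_self W) (by positivity)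
    have h2 : |W| * dist p x ^ 3 ≤ |W| * ℓ ^ 3 :=
      mul_le_mul_of_nonneg_left (pow_le_pow_left₀ dist_nonneg hrℓ 3) (abs_nonneg W)
    have h3 : 0 ≤ ℓ ^ 3 := by positivity
    linarith [hcon d hd hdp hdq]

end Summit.CriticalPhenomena.CardyFormulaZ2.Cruxes.VoronoiHubFromSmirnov.MoebiusExactDelaunayDilationWard

end
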